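import Literature.NumberTheory.Automorphic.UnitaryGroupTransferAwayH
import HarnessLib

/-!
# Assembling pure test tensors from prescribed local factors (Rogawski (1990), §14.2 p. 233, §4.9 p. 54: «`f′ = ⊗ f′_v`», «`f = Π f_v`»)

Topic `NumberTheory/Rogawski1990` (sequel to ★ `TestFunctions`, `TestFunctionsPair`, `TestFunctionsNonempty`; ENGINE T1 of the cell
`hodgecm-mathlib`, line `F0_T1InnerFormTraceIdentity`, brick «T1g-ASSEMBLE»); namespace `Literature.NumberTheory.Automorphic.UnitaryGroup` as in those
files. THEOREMS ONLY (no definition, no named fact, no instance, no notation).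

The existence of transfers (law T1g of the line, [Rogawski1990] Prop. 4.9.1) is proved PLACE BY PLACE: at the finitely many places of a bad set
`S′` one is handed local factors `φ_v ∈ C_c^∞(G_v)` (locally constant, compactly supported — the local transfers of the named fact), at all
other finite places the factor is the unit `1_{K_v}` of the Hecke algebra, and at infinity any smooth compactly supported factor will do for the
finite-place statement. This file ASSEMBLES such data into the tree's pure tensors:

* `PureTensor.exists_isTest_loc_eq` — on `U(H)(𝔸_{L⁺})`: for a finite `S′` and `φ_v` (`v ∈ S′`) locally constant with compact support there is a
  TEST tensor `T` (`T.IsTest`: unramified levels `U(H)(𝒪_v)`, smooth at the bad places, `IsArchTest` at infinity by the tree's archimedean bump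
  ★ `exists_archBump`) with `T.S = S′`, `T.loc v = φ_v` on `S′`, `T.loc v = 1_{U(H)(𝒪_v)}` off `S′`, and `T.arch 1 = 1`;
* `PureTensor₂.exists_isUnramified₂_loc_eq` — on the endoscopic side `U(H₂)(𝔸) × U(H₁)(𝔸)`: the same with ★ `PureTensor₂` (levels
  `U(H₂)(𝒪_v) × U(H₁)(𝒪_v)`, unit factors off `S′`, archimedean Urysohn bump ★ `exists_arch_bump₂`), together with the continuity ∕ compact-support
  side conditions under which ★ `PureTensor₂.toCc` applies;
* `exists_globalTransferAwayH_loc_eq`, `exists_globalTransferAwayH_loc_eq_of_smooth` — **the H-side assembly**: for a test tensor `T` on `U(H)` (resp.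
  a smooth `f′ = T.eval`), a finite `S₀` and prescribed smooth local factors `φ_v` on `S₀ ∪ T.S`, there is an unramified `T^H` with bad set
  `S₀ ∪ T.S`, `T^H.loc v = φ_v` there, units elsewhere, and `GlobalTransferAwayH L S₀ f′ (T^H.toCc …)` (★ `UnitaryGroupTransferAwayH`) — the
  shape in which the line's anchored `TransferExistence` consumes the place-by-place transfers [Rogawski1990, Prop. 4.9.1 (a)(b) p. 54].

## References
* J. Rogawski, *Automorphic Representations of Unitary Groups in Three Variables*, Ann. of Math. Stud. 123 (1990), §4.9 p. 54, §14.2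
  p. 233 (print) [Rogawski1990].
* A. Borel, H. Jacquet, *Automorphic forms and automorphic representations*, PSPM 33.1 (1979), §4.1 [BorelJacquet1979].
-/

set_option autoImplicit false

noncomputable section

open NumberField IsDedekindDomain Filter Set
open NumberField.mixedEmbedding (mixedSpace)
open scoped Classical

namespace Literature.NumberTheory.Automorphic.UnitaryGroup

variable (L : Type) [Field L] [NumberField L] [IsCMField L] {N N₂ N₁ : ℕ} (H : Matrix (Fin N) (Fin N) L)
  (H₂ : Matrix (Fin N₂) (Fin N₂) L) (H₁ : Matrix (Fin N₁) (Fin N₁) L)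

/-! ## §1 Test tensors on `U(H)(𝔸)` with prescribed bad factors -/

/-- **A test tensor with prescribed local factors.** For a finite set `S′` of finite places of `L⁺` and local factors `φ_v : U(H)(L⁺_v) → ℂ`
locally constant with compact support for `v ∈ S′`, there is a pure tensor `T` with `T.IsTest`, bad set `T.S = S′`, `T.loc v = φ_v` for `v ∈ S′`,
unit factors `1_{U(H)(𝒪_v)}` and integral levels off `S′`, and archimedean factor the restriction of the tree's smooth bump (`T.arch 1 = 1`)
— «`f′ = ⊗ f′_v`, `f′_v` the characteristic function of `K′_v` for almost all `v`» [Rogawski1990, §14.2 p. 233]. (★ `PureTensor.ofUnramified` +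
★ `exists_archBump`.) [cite: Rogawski1990, §14.2 p. 233] [cite: BorelJacquet1979, §4.1] -/
theorem PureTensor.exists_isTest_loc_eq (S' : Finset (HeightOneSpectrum (𝓞 ↥(maximalRealSubfield L))))
    (φ : ∀ v : HeightOneSpectrum (𝓞 ↥(maximalRealSubfield L)), (cmDatum L N H).Local v → ℂ)
    (hφ : ∀ v ∈ S', IsLocallyConstant (φ v) ∧ HasCompactSupport (φ v)) :
    ∃ T : PureTensor L N H, T.IsTest ∧ T.S = S' ∧ (∀ v ∈ S', T.loc v = φ v) ∧
      (∀ v, T.K v = cmLocalIntegralLevel L N H v) ∧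
      (∀ v ∉ S', T.loc v = (cmLocalIntegralLevel L N H v : Set ((cmDatum L N H).Local v)).indicator fun _ => 1) ∧ T.arch 1 = 1 := by
  obtain ⟨ψ, hc, hs, hsm, h1⟩ := exists_archBump L N
  let f : UnitaryGroup.arch (↥(maximalRealSubfield L)) L (IsCMField.complexConj L) N H → ℂ := fun k => ψ (k : GL (Fin N) (mixedSpace L))
  refine ⟨PureTensor.ofUnramified L N H S' φ f,
    ⟨PureTensor.ofUnramified_isUnramified _ _ _, PureTensor.ofUnramified_isFinSmooth f hφ, ⟨ψ, hc, hs, hsm, fun _ => rfl⟩⟩, rfl,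
    fun v hv => PureTensor.ofUnramified_loc_of_mem φ f hv, fun _ => rfl, fun v hv => ?_, ?_⟩
  · show (if v ∈ S' then φ v else _) = _
    rw [if_neg hv]
  · show ψ ((1 : UnitaryGroup.arch (↥(maximalRealSubfield L)) L (IsCMField.complexConj L) N H) : GL (Fin N) (mixedSpace L)) = 1
    rw [OneMemClass.coe_one, h1]

/-- The same packaged in `C_c(U(H)(𝔸_{L⁺}), ℂ)`: a SMOOTH `f′` (`∃ T, T.IsTest ∧ ⇑f′ = T.eval`, the ENGINE T1 kit's `Smooth`) with the prescribed
local factors on `S′` and `f′ 1 = ∏_{v ∈ S′} φ_v(1)`. [cite: Rogawski1990, §14.2 p. 233] [cite: BorelJacquet1979, §4.1] -/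
theorem exists_smooth_loc_eq (S' : Finset (HeightOneSpectrum (𝓞 ↥(maximalRealSubfield L))))
    (φ : ∀ v : HeightOneSpectrum (𝓞 ↥(maximalRealSubfield L)), (cmDatum L N H).Local v → ℂ)
    (hφ : ∀ v ∈ S', IsLocallyConstant (φ v) ∧ HasCompactSupport (φ v)) :
    ∃ (T : PureTensor L N H) (f' : CompactlySupportedContinuousMap (cmDatum L N H).Adelic ℂ),
      T.IsTest ∧ ⇑f' = T.eval ∧ T.S = S' ∧ (∀ v ∈ S', T.loc v = φ v) ∧ f' 1 = ∏ v ∈ S', φ v 1 := by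
  obtain ⟨T, hT, hS, hloc, hK, -, h1⟩ := PureTensor.exists_isTest_loc_eq L H S' φ hφ
  refine ⟨T, T.toCc hT.isUnramified hT.isArchTest.continuous_arch hT.isArchTest.hasCompactSupport_arch
      (fun v _ => PureTensor.continuous_loc hT.isUnramified hT.isFinSmooth v)
      (fun v _ => PureTensor.hasCompactSupport_loc hT.isUnramified hT.isFinSmooth v), hT, rfl, hS, hloc, ?_⟩
  have hmem : ∀ v ∉ T.S, (cmDatum L N H).toLocal v 1 ∈ T.K v := fun v _ => by
    rw [map_one, hK v]; exact Subgroup.one_mem _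
  rw [PureTensor.toCc_apply, PureTensor.eval_eq_of_forall_mem T 1 hmem]
  have hprod : ∏ v ∈ T.S, T.loc v ((cmDatum L N H).toLocal v 1) = ∏ v ∈ S', φ v 1 := by
    rw [hS]
    exact Finset.prod_congr rfl fun v hv => by rw [hloc v hv, map_one]
  rw [hprod]
  convert one_mul (∏ v ∈ S', φ v 1) using 2
  rw [← h1]
  congr 1
  exact map_one _

/-! ## §2 Unramified tensors on the endoscopic side `U(H₂)(𝔸) × U(H₁)(𝔸)` with prescribed bad factors -/

/-- **An unramified endoscopic tensor with prescribed local factors.** For a finite `S′` and factors `φ_v` on `U(H₂)(L⁺_v) × U(H₁)(L⁺_v)` locally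
constant with compact support for `v ∈ S′`, there is `T^H : PureTensor₂ L H₂ H₁` with `IsUnramified₂` (levels `U(H₂)(𝒪_v) × U(H₁)(𝒪_v)`), bad set
`S′`, `T^H.loc v = φ_v` on `S′`, unit factors off `S′`, a continuous compactly supported archimedean factor with `T^H.arch 1 = 1` (Urysohn, ★
`exists_arch_bump₂`), and the side conditions of ★ `PureTensor₂.toCc` (local factors continuous with compact support on the bad set) —
«`f = Π f_v`, `f_v` the unit of `𝓗(H_v, ω_v)` for almost all `v`» [Rogawski1990, §4.9 p. 54]. [cite: Rogawski1990, §4.9 p. 54] [cite: BorelJacquet1979, §4.1] -/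
theorem PureTensor₂.exists_isUnramified₂_loc_eq (S' : Finset (HeightOneSpectrum (𝓞 ↥(maximalRealSubfield L))))
    (φ : ∀ v : HeightOneSpectrum (𝓞 ↥(maximalRealSubfield L)), (cmDatum L N₂ H₂).Local v × (cmDatum L N₁ H₁).Local v → ℂ)
    (hφ : ∀ v ∈ S', IsLocallyConstant (φ v) ∧ HasCompactSupport (φ v)) :
    ∃ TH : PureTensor₂ L H₂ H₁, TH.IsUnramified₂ ∧ TH.S = S' ∧ (∀ v ∈ S', TH.loc v = φ v) ∧
      (∀ v ∉ S', TH.loc v = ((cmLocalIntegralLevel L N₂ H₂ v : Set ((cmDatum L N₂ H₂).Local v)) ×ˢ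
        (cmLocalIntegralLevel L N₁ H₁ v : Set ((cmDatum L N₁ H₁).Local v))).indicator fun _ => 1) ∧
      Continuous TH.arch ∧ HasCompactSupport TH.arch ∧ TH.arch 1 = 1 ∧
      (∀ v ∈ TH.S, Continuous (TH.loc v)) ∧ (∀ v ∈ TH.S, HasCompactSupport (TH.loc v)) := by
  obtain ⟨ψ, hψ, hψc, hψ1⟩ := exists_arch_bump₂ L H₂ H₁
  let TH : PureTensor₂ L H₂ H₁ :=
    { S := S'
      K₂ := fun v => cmLocalIntegralLevel L N₂ H₂ v
      K₁ := fun v => cmLocalIntegralLevel L N₁ H₁ v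
      loc := fun v => if v ∈ S' then φ v else
        ((cmLocalIntegralLevel L N₂ H₂ v : Set ((cmDatum L N₂ H₂).Local v)) ×ˢ
          (cmLocalIntegralLevel L N₁ H₁ v : Set ((cmDatum L N₁ H₁).Local v))).indicator fun _ => 1
      arch := fun k => (ψ k : ℂ)
      loc_eq_indicator := fun v hv => by simp only [if_neg (show v ∉ S' from hv)] }
  have hloc : ∀ v ∈ S', TH.loc v = φ v := fun v hv => by
    show (if v ∈ S' then φ v else _) = φ v
    rw [if_pos hv]
  refine ⟨TH, fun _ _ => ⟨rfl, rfl⟩, rfl, hloc, fun v hv => ?_, Complex.continuous_ofReal.comp hψ, hψc.comp_left Complex.ofReal_zero, ?_,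
    fun v hv => ?_, fun v hv => ?_⟩
  · show (if v ∈ S' then φ v else _) = _
    rw [if_neg hv]
  · show ((ψ 1 : ℝ) : ℂ) = 1
    rw [hψ1, Complex.ofReal_one]
  · rw [hloc v hv]; exact (hφ v hv).1.continuous
  · rw [hloc v hv]; exact (hφ v hv).2

/-! ## §3 The H-side assembly: `GlobalTransferAwayH` with prescribed bad factors -/

/-- **The endoscopic away-partner with PRESCRIBED local factors.** For a test tensor `T` on `U(H)(𝔸)`, a finite `S₀` and local factors `φ_v` on
`U(H₂)(L⁺_v) × U(H₁)(L⁺_v)`, locally constant with compact support for `v ∈ S₀ ∪ T.S` (in the line: the local transfers of the `T.loc v` handed over by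
[Rogawski1990, Prop. 4.9.1 (a)]), there is an unramified `T^H` with bad set EXACTLY `S₀ ∪ T.S`, `T^H.loc v = φ_v` there, units elsewhere, packaged as
`f^H = T^H.toCc … ∈ C_c`, and `GlobalTransferAwayH L S₀ (T.toCc …) f^H` (★ `UnitaryGroupTransferAwayH`: unramified pure tensors with `T^H.S ⊆ S₀ ∪ T.S`).
[cite: Rogawski1990, §4.9 p. 54] [cite: Rogawski1990, §14.2 p. 233] -/
theorem exists_globalTransferAwayH_loc_eq (S₀ : Finset (HeightOneSpectrum (𝓞 ↥(maximalRealSubfield L)))) (T : PureTensor L N H)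
    (hT : T.IsTest) (φ : ∀ v : HeightOneSpectrum (𝓞 ↥(maximalRealSubfield L)), (cmDatum L N₂ H₂).Local v × (cmDatum L N₁ H₁).Local v → ℂ)
    (hφ : ∀ v ∈ S₀ ∪ T.S, IsLocallyConstant (φ v) ∧ HasCompactSupport (φ v)) :
    ∃ (TH : PureTensor₂ L H₂ H₁) (hTH : TH.IsUnramified₂) (harch : Continuous TH.arch) (harch' : HasCompactSupport TH.arch)
      (hl : ∀ v ∈ TH.S, Continuous (TH.loc v)) (hl' : ∀ v ∈ TH.S, HasCompactSupport (TH.loc v)),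
      TH.S = S₀ ∪ T.S ∧ (∀ v ∈ S₀ ∪ T.S, TH.loc v = φ v) ∧
      (∀ v ∉ S₀ ∪ T.S, TH.loc v = ((cmLocalIntegralLevel L N₂ H₂ v : Set ((cmDatum L N₂ H₂).Local v)) ×ˢ
        (cmLocalIntegralLevel L N₁ H₁ v : Set ((cmDatum L N₁ H₁).Local v))).indicator fun _ => 1) ∧ TH.arch 1 = 1 ∧
      GlobalTransferAwayH L S₀
        (T.toCc hT.isUnramified hT.isArchTest.continuous_arch hT.isArchTest.hasCompactSupport_arch
          (fun v _ => PureTensor.continuous_loc hT.isUnramified hT.isFinSmooth v)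
          (fun v _ => PureTensor.hasCompactSupport_loc hT.isUnramified hT.isFinSmooth v))
        (TH.toCc hTH harch harch' hl hl') := by
  obtain ⟨TH, hTH, hS, hloc, hoff, harch, harch', h1, hl, hl'⟩ := PureTensor₂.exists_isUnramified₂_loc_eq L H₂ H₁ (S₀ ∪ T.S) φ hφ
  exact ⟨TH, hTH, harch, harch', hl, hl', hS, hloc, hoff, h1, T, TH, hT.isUnramified, hTH, rfl, rfl, by rw [hS]⟩

/-- **The H-side assembly for a SMOOTH `f′`** (`⇑f′ = T.eval`, `T.IsTest` — the ENGINE T1 kit's `Smooth f′`): given local factors `φ_v` on the finite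
set `S₀ ∪ T.S` (locally constant, compactly supported), some `f^H ∈ C_c(U(H₂)(𝔸) × U(H₁)(𝔸))` is the evaluation of an unramified `T^H` with bad
set `S₀ ∪ T.S`, `T^H.loc v = φ_v` there and unit factors elsewhere, and `GlobalTransferAwayH L S₀ f′ f^H`. This is the bookkeeping half of
[Rogawski1990, Prop. 4.9.1]: the analytic input (existence of the `φ_v` as Δ-transfers of the `f′_v`, and the fundamental lemma «unit ↦ unit» off
the bad set) is supplied by the consumer. [cite: Rogawski1990, §4.9 p. 54] [cite: Rogawski1990, §14.2 p. 233] -/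
theorem exists_globalTransferAwayH_loc_eq_of_smooth (S₀ : Finset (HeightOneSpectrum (𝓞 ↥(maximalRealSubfield L))))
    (f' : CompactlySupportedContinuousMap (cmDatum L N H).Adelic ℂ) (T : PureTensor L N H) (hT : T.IsTest) (hf' : ⇑f' = T.eval)
    (φ : ∀ v : HeightOneSpectrum (𝓞 ↥(maximalRealSubfield L)), (cmDatum L N₂ H₂).Local v × (cmDatum L N₁ H₁).Local v → ℂ)
    (hφ : ∀ v ∈ S₀ ∪ T.S, IsLocallyConstant (φ v) ∧ HasCompactSupport (φ v)) :
    ∃ (TH : PureTensor₂ L H₂ H₁) (fH : CompactlySupportedContinuousMap ((cmDatum L N₂ H₂).Adelic × (cmDatum L N₁ H₁).Adelic) ℂ),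
      TH.IsUnramified₂ ∧ ⇑fH = TH.eval ∧ TH.S = S₀ ∪ T.S ∧ (∀ v ∈ S₀ ∪ T.S, TH.loc v = φ v) ∧
      (∀ v ∉ S₀ ∪ T.S, TH.loc v = ((cmLocalIntegralLevel L N₂ H₂ v : Set ((cmDatum L N₂ H₂).Local v)) ×ˢ
        (cmLocalIntegralLevel L N₁ H₁ v : Set ((cmDatum L N₁ H₁).Local v))).indicator fun _ => 1) ∧
      GlobalTransferAwayH L S₀ f' fH := by
  obtain ⟨TH, hTH, hS, hloc, hoff, harch, harch', -, hl, hl'⟩ := PureTensor₂.exists_isUnramified₂_loc_eq L H₂ H₁ (S₀ ∪ T.S) φ hφ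
  exact ⟨TH, TH.toCc hTH harch harch' hl hl', hTH, rfl, hS, hloc, hoff, T, TH, hT.isUnramified, hTH, hf', rfl, by rw [hS]⟩

/-! ## §4 (ed. 2) Prescribed ARCHIMEDEAN factors

[Rogawski1990, §14.2 (14.2.1) p. 233] compares `f′_v` and `f_v` also at the INFINITE places (`v ∈ S₀`: «the existence of `f_v` follows from
results of Shelstad»), and §14.3 p. 234 transfers `f′_∞ ↦ f′^H_∞`; an edition of the line pinning these archimedean relations on
`T.arch`, `T′.arch`, `T^H.arch` needs the assembled tensors with a PRESCRIBED archimedean factor (the archimedean transfer handed over by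
the named facts) instead of an arbitrary bump. The G-side test class at infinity is the tree's `IsArchTest` clause (restriction of a smooth
compactly supported function on `GL_N(L ⊗ ℝ)`); on the H-side product only continuity and compact support are needed for `toCc`. -/

open scoped Matrix.Norms.Operator in
/-- **A test tensor with prescribed local AND archimedean factors**: as `PureTensor.exists_isTest_loc_eq`, with `T.arch = a` for a given
`a : U(H)(L⁺ ⊗ ℝ) → ℂ` in the `IsArchTest` class (`a` is the restriction of a continuous, compactly supported `Φ` on `GL_N(L ⊗ ℝ)` smooth in
the sense of ★ `IsArchSmooth (archGroupGL N L).carrier.subtype`). [cite: Rogawski1990, §14.2 p. 233] [cite: BorelJacquet1979, §4.1] -/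
theorem PureTensor.exists_isTest_loc_eq_arch_eq (S' : Finset (HeightOneSpectrum (𝓞 ↥(maximalRealSubfield L))))
    (φ : ∀ v : HeightOneSpectrum (𝓞 ↥(maximalRealSubfield L)), (cmDatum L N H).Local v → ℂ)
    (hφ : ∀ v ∈ S', IsLocallyConstant (φ v) ∧ HasCompactSupport (φ v))
    (a : UnitaryGroup.arch (↥(maximalRealSubfield L)) L (IsCMField.complexConj L) N H → ℂ)
    (ha : ∃ Φ : GL (Fin N) (mixedSpace L) → ℂ, Continuous Φ ∧ HasCompactSupport Φ ∧
      IsArchSmooth (archGroupGL N L).carrier.subtype Φ ∧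
      ∀ k : UnitaryGroup.arch (↥(maximalRealSubfield L)) L (IsCMField.complexConj L) N H, a k = Φ (k : GL (Fin N) (mixedSpace L))) :
    ∃ T : PureTensor L N H, T.IsTest ∧ T.S = S' ∧ (∀ v ∈ S', T.loc v = φ v) ∧
      (∀ v, T.K v = cmLocalIntegralLevel L N H v) ∧
      (∀ v ∉ S', T.loc v = (cmLocalIntegralLevel L N H v : Set ((cmDatum L N H).Local v)).indicator fun _ => 1) ∧ T.arch = a := by
  obtain ⟨Φ, hc, hs, hsm, haΦ⟩ := ha
  refine ⟨PureTensor.ofUnramified L N H S' φ a,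
    ⟨PureTensor.ofUnramified_isUnramified _ _ _, PureTensor.ofUnramified_isFinSmooth a hφ, ⟨Φ, hc, hs, hsm, haΦ⟩⟩, rfl,
    fun v hv => PureTensor.ofUnramified_loc_of_mem φ a hv, fun _ => rfl, fun v hv => ?_, rfl⟩
  show (if v ∈ S' then φ v else _) = _
  rw [if_neg hv]

open scoped Matrix.Norms.Operator in
/-- **The G-side transfer partner with a prescribed archimedean factor** (★ `PureTensor.exists_isTest_forall_loc_eq_comp_symm` with the arch
bump replaced by a given `IsArchTest`-class `a` on `U(H′)(L⁺ ⊗ ℝ)`): `ψ_v` matching the integral levels off `S₀`, `T` unramified and finitely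
smooth on `U(H)` ⇒ `T′` on `U(H′)` with `T′.IsTest`, `T′.S = S₀ ∪ T.S`, `T′.loc v = T.loc v ∘ ψ_v⁻¹` at EVERY finite `v`, and `T′.arch = a`.
[cite: Rogawski1990, §14.2 p. 233] [cite: BorelJacquet1979, §4.1] -/
theorem PureTensor.exists_isTest_forall_loc_eq_comp_symm_arch_eq {H' : Matrix (Fin N) (Fin N) L}
    (ψ : ∀ v : HeightOneSpectrum (𝓞 ↥(maximalRealSubfield L)), (cmDatum L N H).Local v ≃ₜ* (cmDatum L N H').Local v)
    (S₀ : Finset (HeightOneSpectrum (𝓞 ↥(maximalRealSubfield L))))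
    (hψ : ∀ v ∉ S₀, ∀ g, ψ v g ∈ cmLocalIntegralLevel L N H' v ↔ g ∈ cmLocalIntegralLevel L N H v)
    (T : PureTensor L N H) (hT : T.IsUnramified) (hS : T.IsFinSmooth)
    (a : UnitaryGroup.arch (↥(maximalRealSubfield L)) L (IsCMField.complexConj L) N H' → ℂ)
    (ha : ∃ Φ : GL (Fin N) (mixedSpace L) → ℂ, Continuous Φ ∧ HasCompactSupport Φ ∧
      IsArchSmooth (archGroupGL N L).carrier.subtype Φ ∧
      ∀ k : UnitaryGroup.arch (↥(maximalRealSubfield L)) L (IsCMField.complexConj L) N H', a k = Φ (k : GL (Fin N) (mixedSpace L))) :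
    ∃ T' : PureTensor L N H', T'.IsTest ∧ T'.S = S₀ ∪ T.S ∧ (∀ v, T'.loc v = T.loc v ∘ (ψ v).symm) ∧ T'.arch = a := by
  -- the partner of ★ `exists_isTest_forall_loc_eq_comp_symm`, with its archimedean factor swapped for `a`
  obtain ⟨T₁, hT₁, hS₁, hloc₁⟩ := PureTensor.exists_isTest_forall_loc_eq_comp_symm L N ψ S₀ hψ T hT hS
  obtain ⟨Φ, hc, hs, hsm, haΦ⟩ := ha
  let T' : PureTensor L N H' :=
    { S := T₁.S, K := T₁.K, loc := T₁.loc, arch := a, loc_eq_indicator := T₁.loc_eq_indicator }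
  exact ⟨T', ⟨fun v hv => hT₁.isUnramified.K_eq hv, fun v hv => hT₁.isFinSmooth v hv, ⟨Φ, hc, hs, hsm, haΦ⟩⟩, hS₁, hloc₁, rfl⟩

open scoped Matrix.Norms.Operator in
/-- **`GlobalTransferAway` with a prescribed archimedean factor on the partner**: for a test tensor `T` on `U(H)` and an `IsArchTest`-class `a` on
`U(H′)(L⁺ ⊗ ℝ)` there is a test partner `T′` with `T′.arch = a`, `T′.loc v = T.loc v ∘ ψ_v⁻¹` at every finite `v`, and
`GlobalTransferAway L N ψ S₀ (T.toCc …) (T′.toCc …)`. [cite: Rogawski1990, §14.2 p. 233] -/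
theorem exists_isTest_globalTransferAway_arch_eq {H' : Matrix (Fin N) (Fin N) L}
    (ψ : ∀ v : HeightOneSpectrum (𝓞 ↥(maximalRealSubfield L)), (cmDatum L N H).Local v ≃ₜ* (cmDatum L N H').Local v)
    (S₀ : Finset (HeightOneSpectrum (𝓞 ↥(maximalRealSubfield L))))
    (hψ : ∀ v ∉ S₀, ∀ g, ψ v g ∈ cmLocalIntegralLevel L N H' v ↔ g ∈ cmLocalIntegralLevel L N H v)
    (T : PureTensor L N H) (hT : T.IsTest)
    (a : UnitaryGroup.arch (↥(maximalRealSubfield L)) L (IsCMField.complexConj L) N H' → ℂ)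
    (ha : ∃ Φ : GL (Fin N) (mixedSpace L) → ℂ, Continuous Φ ∧ HasCompactSupport Φ ∧
      IsArchSmooth (archGroupGL N L).carrier.subtype Φ ∧
      ∀ k : UnitaryGroup.arch (↥(maximalRealSubfield L)) L (IsCMField.complexConj L) N H', a k = Φ (k : GL (Fin N) (mixedSpace L))) :
    ∃ (T' : PureTensor L N H') (hT' : T'.IsTest), T'.S = S₀ ∪ T.S ∧ (∀ v, T'.loc v = T.loc v ∘ (ψ v).symm) ∧ T'.arch = a ∧
      GlobalTransferAway L N ψ S₀
        (T.toCc hT.isUnramified hT.isArchTest.continuous_arch hT.isArchTest.hasCompactSupport_arch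
          (fun v _ => PureTensor.continuous_loc hT.isUnramified hT.isFinSmooth v)
          (fun v _ => PureTensor.hasCompactSupport_loc hT.isUnramified hT.isFinSmooth v))
        (T'.toCc hT'.isUnramified hT'.isArchTest.continuous_arch hT'.isArchTest.hasCompactSupport_arch
          (fun v _ => PureTensor.continuous_loc hT'.isUnramified hT'.isFinSmooth v)
          (fun v _ => PureTensor.hasCompactSupport_loc hT'.isUnramified hT'.isFinSmooth v)) := by
  obtain ⟨T', hT', hS', hloc, harch⟩ :=
    PureTensor.exists_isTest_forall_loc_eq_comp_symm_arch_eq L H ψ S₀ hψ T hT.isUnramified hT.isFinSmooth a ha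
  exact ⟨T', hT', hS', hloc, harch, T, T', rfl, rfl, fun v _ => hloc v⟩

/-- **An unramified endoscopic tensor with prescribed local AND archimedean factors**: as `PureTensor₂.exists_isUnramified₂_loc_eq`, with
`T^H.arch = a` for a given continuous compactly supported `a` on `U(H₂)(L⁺ ⊗ ℝ) × U(H₁)(L⁺ ⊗ ℝ)` (the side conditions of ★ `PureTensor₂.toCc`
hold). [cite: Rogawski1990, §4.9 p. 54] [cite: BorelJacquet1979, §4.1] -/
theorem PureTensor₂.exists_isUnramified₂_loc_eq_arch_eq (S' : Finset (HeightOneSpectrum (𝓞 ↥(maximalRealSubfield L))))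
    (φ : ∀ v : HeightOneSpectrum (𝓞 ↥(maximalRealSubfield L)), (cmDatum L N₂ H₂).Local v × (cmDatum L N₁ H₁).Local v → ℂ)
    (hφ : ∀ v ∈ S', IsLocallyConstant (φ v) ∧ HasCompactSupport (φ v))
    (a : UnitaryGroup.arch (↥(maximalRealSubfield L)) L (IsCMField.complexConj L) N₂ H₂ ×
      UnitaryGroup.arch (↥(maximalRealSubfield L)) L (IsCMField.complexConj L) N₁ H₁ → ℂ)
    (ha : Continuous a) (ha' : HasCompactSupport a) :
    ∃ TH : PureTensor₂ L H₂ H₁, TH.IsUnramified₂ ∧ TH.S = S' ∧ (∀ v ∈ S', TH.loc v = φ v) ∧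
      (∀ v ∉ S', TH.loc v = ((cmLocalIntegralLevel L N₂ H₂ v : Set ((cmDatum L N₂ H₂).Local v)) ×ˢ
        (cmLocalIntegralLevel L N₁ H₁ v : Set ((cmDatum L N₁ H₁).Local v))).indicator fun _ => 1) ∧
      TH.arch = a ∧ Continuous TH.arch ∧ HasCompactSupport TH.arch ∧
      (∀ v ∈ TH.S, Continuous (TH.loc v)) ∧ (∀ v ∈ TH.S, HasCompactSupport (TH.loc v)) := by
  let TH : PureTensor₂ L H₂ H₁ :=
    { S := S'
      K₂ := fun v => cmLocalIntegralLevel L N₂ H₂ v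
      K₁ := fun v => cmLocalIntegralLevel L N₁ H₁ v
      loc := fun v => if v ∈ S' then φ v else
        ((cmLocalIntegralLevel L N₂ H₂ v : Set ((cmDatum L N₂ H₂).Local v)) ×ˢ
          (cmLocalIntegralLevel L N₁ H₁ v : Set ((cmDatum L N₁ H₁).Local v))).indicator fun _ => 1
      arch := a
      loc_eq_indicator := fun v hv => by simp only [if_neg (show v ∉ S' from hv)] }
  have hloc : ∀ v ∈ S', TH.loc v = φ v := fun v hv => by
    show (if v ∈ S' then φ v else _) = φ v
    rw [if_pos hv]
  refine ⟨TH, fun _ _ => ⟨rfl, rfl⟩, rfl, hloc, fun v hv => ?_, rfl, ha, ha', fun v hv => ?_, fun v hv => ?_⟩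
  · show (if v ∈ S' then φ v else _) = _
    rw [if_neg hv]
  · rw [hloc v hv]; exact (hφ v hv).1.continuous
  · rw [hloc v hv]; exact (hφ v hv).2

/-- **The H-side assembly with prescribed bad factors AND prescribed archimedean factor**, for a SMOOTH `f′ = T.eval`: some `f^H = T^H.eval ∈ C_c`
with `T^H` unramified, bad set `S₀ ∪ T.S`, `T^H.loc v = φ_v` there, units elsewhere, `T^H.arch = a`, and `GlobalTransferAwayH L S₀ f′ f^H` — the
form in which an edition pinning BOTH the finite-place Δ-transfers [Rogawski1990, Prop. 4.9.1] and the archimedean transfer [§14.3 p. 234]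
consumes the place-by-place data. [cite: Rogawski1990, §4.9 p. 54] [cite: Rogawski1990, §14.3 p. 234] -/
theorem exists_globalTransferAwayH_loc_eq_arch_eq_of_smooth (S₀ : Finset (HeightOneSpectrum (𝓞 ↥(maximalRealSubfield L))))
    (f' : CompactlySupportedContinuousMap (cmDatum L N H).Adelic ℂ) (T : PureTensor L N H) (hT : T.IsTest) (hf' : ⇑f' = T.eval)
    (φ : ∀ v : HeightOneSpectrum (𝓞 ↥(maximalRealSubfield L)), (cmDatum L N₂ H₂).Local v × (cmDatum L N₁ H₁).Local v → ℂ)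
    (hφ : ∀ v ∈ S₀ ∪ T.S, IsLocallyConstant (φ v) ∧ HasCompactSupport (φ v))
    (a : UnitaryGroup.arch (↥(maximalRealSubfield L)) L (IsCMField.complexConj L) N₂ H₂ ×
      UnitaryGroup.arch (↥(maximalRealSubfield L)) L (IsCMField.complexConj L) N₁ H₁ → ℂ)
    (ha : Continuous a) (ha' : HasCompactSupport a) :
    ∃ (TH : PureTensor₂ L H₂ H₁) (fH : CompactlySupportedContinuousMap ((cmDatum L N₂ H₂).Adelic × (cmDatum L N₁ H₁).Adelic) ℂ),
      TH.IsUnramified₂ ∧ ⇑fH = TH.eval ∧ TH.S = S₀ ∪ T.S ∧ (∀ v ∈ S₀ ∪ T.S, TH.loc v = φ v) ∧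
      (∀ v ∉ S₀ ∪ T.S, TH.loc v = ((cmLocalIntegralLevel L N₂ H₂ v : Set ((cmDatum L N₂ H₂).Local v)) ×ˢ
        (cmLocalIntegralLevel L N₁ H₁ v : Set ((cmDatum L N₁ H₁).Local v))).indicator fun _ => 1) ∧ TH.arch = a ∧
      GlobalTransferAwayH L S₀ f' fH := by
  obtain ⟨TH, hTH, hS, hloc, hoff, harch, hc, hc', hl, hl'⟩ :=
    PureTensor₂.exists_isUnramified₂_loc_eq_arch_eq L H₂ H₁ (S₀ ∪ T.S) φ hφ a ha ha'
  exact ⟨TH, TH.toCc hTH hc hc' hl hl', hTH, rfl, hS, hloc, hoff, harch, T, TH, hT.isUnramified, hTH, hf', rfl, by rw [hS]⟩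

end Literature.NumberTheory.Automorphic.UnitaryGroup

end
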